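/-
Copyright (c) 2026 the pub-hodgecm-mathlib formalisation cell (harness21).  Prover seat hodgecm-mathlib-R90-C10-p02 (g3), SLAB R90-TF, section S1 «Ch. 10∕12 local»
(base R90-C10); crux H413 = `stmt-HodgeConjecture-24833`; line (D-1) «B_pos at INERT places» of U4Keys :182 (S1 junction A2′), memo
`R90/R90-C10-p05/g2/DESIGN-Bpos-inert.md` f70d293d60bf8a4b; card «LEAF ASSEMBLER BODY, hypothesis-first» dealt BY NAME by R90-C10-plan (g2) 2026-09-05T00:14:28Z
(ruling R-S1-17: the all-inert leaf (B-7⁺), head pen R90-C10-p05 (g2)).  KERNEL module: THEOREMS ONLY (no definition, no named fact, no `sorry`, no instance, no notation).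
-/
import Summits.HodgeConjecture.HodgeConjecture.Theorems.R90S1BposBranchBTypeBasisTwoDepthCM     -- ★ p863439 (B-1′) (R90-C10-p05 (g2)): `exists_normalised_typeBasis_twoDepth_of_normChar_eq_one`; brings ★ `K2E3BranchAIrreducibleTwoDepth.levelGroup_le_iwahori`, ★ p862547 letters
import Summits.HodgeConjecture.HodgeConjecture.Theorems.K2E3BranchATypeVectorTwoDepth           -- ★ p863411 (B-1a) (K2E3-p34 (g2)): `exists_typeVector_twoDepth` (the `(J_e, θ)`-type vector of a reducible `i(χ₁, 1)`, `∀ g` kernel clause)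
import Summits.HodgeConjecture.HodgeConjecture.Theorems.R90S1BposCellCoverTwoDepthKZeroCM         -- ★ p863461 (B-2b″) (R90-C10-p08 (g2)): `cells_cover_kZero`, `cells_witness_kZero`; brings ★ `norm_apply_uniformizer_lt_one`, ★ `exists_add_galAdicCompletionMap_eq_one`
import Summits.HodgeConjecture.HodgeConjecture.Theorems.R90S1BranchBDeterminantVanishingCells     -- ★ p862976 (B-0) (R90-C10-p05 (g2)): `det_intertwiningIntegral_eq_zero_of_typeVector_of_cells` (generic)
import Summits.HodgeConjecture.HodgeConjecture.Theorems.R90S1BposDeterminantClosedForm            -- ★ p863308 (B-6) (R90-C10-p01 (g3)): `exists_eta_of_det_eq_zero_of_pairEntries_twoDepth`; brings ★ Z5 `apply_eq_one_of_branchB_of_fixed`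
import Summits.HodgeConjecture.HodgeConjecture.Theorems.R90S1BposCongruencePackTheta              -- ★ p863453 (B-8) (R90-C10-p06 (g3)): `exists_isOpen_subgroup_theta_eq_one`, `theta_mul_twoDepth` (the θ-letters of (B-1′))
import Summits.HodgeConjecture.HodgeConjecture.Theorems.K2E3LocalCharacterConductorLetters        -- ★ p862864 (B1) (K2E3-p34 (g2)): `exists_conductor_letters` (`m`, `hcond`, `u₁` from `h₁ ∧ hpos`)
import Summits.HodgeConjecture.HodgeConjecture.Theorems.F0P3cStCharTSTorusCompactPart             -- ★ `mem_unitsIntegers_iff` (`u ∈ 𝒪ˣ ⟺ ∀ w′, |u_{w′}| = 1`)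
import HarnessLib

/-!
# R90-TF · S1 «Ch10-local» ∕ K2 E3 «U4Keys» :182, BRANCH B AT POSITIVE DEPTH (all inert places) — THE LEAF ASSEMBLER, HYPOTHESIS-FIRST:
# `i(χ₁, 1)` reducible, `χ₁` continuous non-unitary contracting of POSITIVE depth with `χ₁(u·σu) = 1` on units (Branch B), `v` inert ⟹ `χ₁ = η·‖·‖^{1∕2}` —
# GIVEN the four Casselman-pair entries `Λ_1 f₁, Λ_{w₀} f_w, Λ_1 f_w, Λ_{w₀} f₁` on the `(J_e, θ)`-plane in closed form (the LETTERS of ★ (B-6))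
# [Keys1984 §3, §7 Thm (2); Casselman1980 §3; Casselman1995 §6.3–§6.4; Roche1998 §3–§4; Rogawski1990 §12.2]

Cell `pub/hodgecm-mathlib`, crux H413 = `stmt-HodgeConjecture-24833`, route of record `HCCMUnconditional` (no route verbs); R90-TF section S1 (junction socket A2′ = U4Keys :217, REL
over :155 and :182).  THEOREMS ONLY; lane `--supports stmt-HodgeConjecture-24833 --as helper`, count-neutral.  NOT THE PAYER of :182: the four ENTRY VALUES are the hypothesis `HE` here
(payers = the integral side of the line: ★ (B-4), (B-5) parts 1–3 (R90-C10-p05 (g2)), (B-9c) (R90-C10-p01 (g3))); the head (B-7⁺) `exists_eta_of_reducible_posDepth_normTrivial_inertAll`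
(R-S1-17; pen R90-C10-p05 (g2)) is APPENDED here when they are ★ (= §2 applied to their names), with the frozen (B-7) head d21b054346b3bcdc (`…_inert`, with `h2`) as its corollary.
THE POINT (memo §0, §2, §4).  The d0B programme «reducible ⟹ `(B, θ)`-type vector killed by `Λ_g` ⟹ `det M = 0` on the type plane ⟹ `X = −1∕q` ⟹ `χ₁ = η‖·‖^{1∕2}`» run at Roche's
two-depth group `B = J_e`, `e = (r₁, 0; r₂, 1)`, `r₁ + r₂ = n = m + 1 = cond_E χ₁ ≥ 2`, `r₁ ≤ r₂ ≤ r₁ + 1`.  Every arrow is ★ by name; this module is the COMPOSITION: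
* §0 **`apply_eq_one_of_map_conjLocal_eq_of_valued_sub_one_le`** — in Branch B at an inert place the F-conductor letter `hcondF` of ★ (B-1a) ∕ ★ (B-8) holds at EVERY level `c ≥ 1`.
* §1 **`exists_eta_of_reducible_twoDepth_of_pairEntries`** — (G3)-frame + `(r₁ r₂ Jg hJg Je hJe)` + `w₀` of matrix `Φ₃` + a Haar measure `μ` on `N(L⁺_v)`; GIVEN a normalised `(J_e, θ)`-type
  basis `(f₁, f_w)` with its four cell integrals integrable and IN CLOSED FORM (★ (B-6)'s letters `h11v hwwv hw1v h1wv` VERBATIM at `Λ11 := ∫ f₁(w₀ n) dμ`, `Λww := ∫ f_w(w₀ n w₀) dμ`,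
  `Λw1 := ∫ f_w(w₀ n) dμ`, `Λ1w := ∫ f₁(w₀ n w₀) dμ`, `n := m + 1`, `(r, r′) := (r₁, r₂)`), reducibility gives `∃ η`: ★ (B-1a) → ★ (B-2b″) → ★ (B-0) → ★ `norm_apply_uniformizer_lt_one` → ★ (B-6).
* §2 **`exists_eta_of_reducible_posDepth_normTrivial_inertAll_of_pairEntries`** — FRAME-FREE, leaf-shaped: the binders of the head (B-7⁺) (= frozen (B-7) d21b054346b3bcdc with `h2` DELETED,
  `hram` dropped as unused) plus ONE letter `HE` = «for every frame, conductor datum `(m, hcond, u₁)`, aligned `(r₁, r₂, Jg, Je)`, `w₀` of matrix `Φ₃`, Borel Haar `μ` on `N(L⁺_v)` and every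
  normalised `(J_e, θ)`-type basis `(f₁, f_w)`: the four cell integrals are integrable and take ★ (B-6)'s closed forms for SOME `V ≠ 0`, `ε₀² = 1`, `c₂² = 1`»; body = ★ (B1) conductor
  letters → frame (★ d0B leaf pattern) → ★ D174 `Jg` → ★ (B-8) θ-letters → ★ (B-1′) basis → `HE` → §1.
HONEST LABEL.  HC_CM is proved only modulo the 7 printed citations (2 remaining named inputs: hLiu418 = `stmt-HodgeConjecture-24832`, h413 = `stmt-HodgeConjecture-24833`) until rung 0
closes; count-neutral — a hypothesis-first leaf body closes NOTHING until its letter `HE` is ★; :182 ∕ A2′ OPEN; REL ≠ ★ ≠ BUILT.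

## References
* [Keys1984] D. Keys, *Principal series representations of special unitary groups over local fields*, Compositio Math. 51 (1984), §3, §7 Theorem (2) (b)–(d) p. 126.
* [Casselman1980] W. Casselman, *The unramified principal series of p-adic groups I*, Compositio Math. 40 (1980), §3.
* [Casselman1995] W. Casselman, *Introduction to the theory of admissible representations of `p`-adic reductive groups* (1995), §6.3–§6.4, Thm. 6.6.2.
* [Roche1998] A. Roche, *Types and Hecke algebras for principal series representations of split reductive p-adic groups*, Ann. Sci. ÉNS (4) 31 (1998), §3–§4.
* [Rogawski1990] J. D. Rogawski, *Automorphic Representations of Unitary Groups in Three Variables*, Ann. of Math. Stud. 123 (1990), §12.1 p. 171, §12.2 (1)–(2) p. 173.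
* [Serre1979] J.-P. Serre, *Local Fields*, GTM 67 (1979), Ch. V §2 Prop. 3.
-/

set_option autoImplicit false
-- the mandated namespace has the single-problem summit's repeated segment (`HodgeConjecture.HodgeConjecture`)
set_option linter.dupNamespace false

noncomputable section

open NumberField IsDedekindDomain MeasureTheory
open scoped Matrix MatrixGroups WithZero Valued NNReal
open Literature.NumberTheory Literature.NumberTheory.Automorphic Literature.NumberTheory.Automorphic.UnitaryGroup
open Literature.NumberTheory.Rogawski1990

namespace Summit.HodgeConjecture.HodgeConjecture.R90.S1.KeysThmTwoPosDepthBranchBInertAllLeaf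

open Summit.HodgeConjecture.HodgeConjecture.Cruxes.H413
open Summit.HodgeConjecture.HodgeConjecture.Cruxes.H413.K2E3DepthZeroIwahoriCharacterCM
open Summit.HodgeConjecture.HodgeConjecture.R90.S1

variable (L : Type) [Field L] [NumberField L] [IsCMField L] (v : HeightOneSpectrum (𝓞 ↥(maximalRealSubfield L)))

/-! ## §0 Branch B at an inert place: the F-conductor letter holds at every level -/

/-- **In Branch B at an inert place, `χ₁ u = 1` for every `σ`-fixed unit `u` with `|u_{w′} − 1|_{w′} ≤ |ϖ|ᶜ` at all `w′ ∣ v`, `1 ≤ c`** — the letter `hcondF` of ★ (B-1a)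
`exists_typeVector_twoDepth` ∕ ★ (B-8) `theta_mul_twoDepth` at ANY level `c ≥ 1`: `|u_{w′} − 1| ≤ |ϖ|ᶜ < 1` forces `|u_{w′}| = 1`, so `u` is a unit-integer (★ `mem_unitsIntegers_iff`)
fixed by `σ`, and ★ Z5 `apply_eq_one_of_branchB_of_fixed` (`v` unramified: `u = z·σz`, `hB`) gives `χ₁ u = 1`. [cite: Serre1979, Ch. V §2 Prop. 3] [cite: Keys1984, §7 Theorem (2) p. 126] -/
theorem apply_eq_one_of_map_conjLocal_eq_of_valued_sub_one_le
    (hns : ∀ w' : PlacesOver L v, IsCMField.complexConj L • w'.1 = w'.1) (hunr : Algebra.IsUnramifiedIn (𝓞 L) v.asIdeal)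
    (w : PlacesOver L v) {ϖ : w.1.adicCompletion L} (hϖ : Valued.v ϖ = WithZero.exp (-1 : ℤ))
    (χ₁ : (LocalRing L v)ˣ →* ℂˣ)
    (hB : ∀ u : (LocalRing L v)ˣ, (∀ w' : PlacesOver L v, Valued.v ((u : LocalRing L v) w') = 1) →
      χ₁ (u * Units.map (conjLocal L (IsCMField.complexConj L) v : LocalRing L v →* LocalRing L v) u) = 1)
    {c : ℕ} (hc : 1 ≤ c) (u : (LocalRing L v)ˣ)
    (hσu : Units.map (conjLocal L (IsCMField.complexConj L) v : LocalRing L v →* LocalRing L v) u = u)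
    (hu : ∀ w' : PlacesOver L v, Valued.v (((u : LocalRing L v) w') - 1) ≤ Valued.v ϖ ^ c) : χ₁ u = 1 := by
  have hvϖ1 : Valued.v ϖ < 1 := by rw [hϖ, ← WithZero.exp_zero, WithZero.exp_lt_exp]; norm_num
  have hlt : Valued.v ϖ ^ c < 1 := pow_lt_one' hvϖ1 (Nat.one_le_iff_ne_zero.1 hc)
  have hu1 : ∀ w' : PlacesOver L v, Valued.v ((u : LocalRing L v) w') = 1 := fun w' => by
    have h := Valued.v.map_one_add_of_lt ((hu w').trans_lt hlt)
    rwa [add_sub_cancel] at h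
  have hσ : conjLocal L (IsCMField.complexConj L) v (u : LocalRing L v) = u := by
    have h := congrArg Units.val hσu
    rwa [Units.coe_map, MonoidHom.coe_coe] at h
  exact K2E3KeysThmTwoDepthZeroBranchBConversion.apply_eq_one_of_branchB_of_fixed L v hns hunr χ₁ hB u
    ((F0P3cStCharTSTorusCompactPart.mem_unitsIntegers_iff L v u).2 hu1) hσ

/-! ## §1 The end assembly in the (G3) frame at Roche's group `J_e`, GIVEN the type basis and the four entries -/

section Frame

variable (w : PlacesOver L v) (hw : IsCMField.complexConj L • w.1 = w.1)
  (eA : Gqs L v ≃ₜ* ↥(unitaryGroupOfForm (galAdicCompletionMap (L := L) (IsCMField.complexConj L) hw) ((StdForm.antidiagonal 3).over (w.1.adicCompletion L))))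
  (heA : ∀ g : Gqs L v,
    ((eA g : ↥(unitaryGroupOfForm (galAdicCompletionMap (L := L) (IsCMField.complexConj L) hw) ((StdForm.antidiagonal 3).over (w.1.adicCompletion L)))) :
        GL (Fin 3) (w.1.adicCompletion L)) =
      ((localNonsplitEquiv (IsCMField.complexConj L) (qsForm L) (IsCMField.complexConj_ne_one L) w hw g :
        ↥(unitaryGroupOfForm (galAdicCompletionMap (L := L) (IsCMField.complexConj L) hw) (placeForm (qsForm L) w.1))) : GL (Fin 3) (w.1.adicCompletion L)))
  {ϖ : w.1.adicCompletion L} (hϖ : Valued.v ϖ = WithZero.exp (-1 : ℤ))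
  (g₁ : GL (Fin 3) (w.1.adicCompletion L)) (hg₁ : (g₁ : Matrix (Fin 3) (Fin 3) (w.1.adicCompletion L)) = Matrix.diagonal ![(1 : w.1.adicCompletion L), 1, ϖ])
  (K0 K1 I : Subgroup (Gqs L v))
  (hK0 : K0 = ((glInt 3 (w.1.adicCompletion L)).subgroupOf
    (unitaryGroupOfForm (galAdicCompletionMap (L := L) (IsCMField.complexConj L) hw) ((StdForm.antidiagonal 3).over (w.1.adicCompletion L)))).comap
      eA.toMulEquiv.toMonoidHom)
  (hK1 : K1 = (((glInt 3 (w.1.adicCompletion L)).map (MulAut.conj g₁).toMonoidHom).subgroupOf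
    (unitaryGroupOfForm (galAdicCompletionMap (L := L) (IsCMField.complexConj L) hw) ((StdForm.antidiagonal 3).over (w.1.adicCompletion L)))).comap
      eA.toMulEquiv.toMonoidHom)
  (hI : I = K0 ⊓ K1)
  (r₁ r₂ : ℕ) (Jg : Subgroup ↥(unitaryGroupOfForm (galAdicCompletionMap (L := L) (IsCMField.complexConj L) hw) ((StdForm.antidiagonal 3).over (w.1.adicCompletion L))))
  (hJg : ∀ k : ↥(unitaryGroupOfForm (galAdicCompletionMap (L := L) (IsCMField.complexConj L) hw) ((StdForm.antidiagonal 3).over (w.1.adicCompletion L))),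
    k ∈ Jg ↔ ∀ i j, Valued.v (((k : GL (Fin 3) (w.1.adicCompletion L)) : Matrix (Fin 3) (Fin 3) (w.1.adicCompletion L)) i j) ≤
      Valued.v ϖ ^ (![![0, r₁, 0], ![r₂, 0, r₁], ![1, r₂, 0]] : Fin 3 → Fin 3 → ℕ) i j)
  (Je : Subgroup (Gqs L v)) (hJe : Je = Jg.comap eA.toMulEquiv.toMonoidHom)
  (w₀ : ↥(unitaryGroupOfForm (conjLocal L (IsCMField.complexConj L) v) (cmLocalForm L 3 v))) (hw₀ : Units.val (w₀ : GL (Fin 3) (LocalRing L v)) = cmLocalForm L 3 v)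

open Classical in
include hw heA hϖ hg₁ hK0 hK1 hI hJg hJe hw₀ in
set_option maxHeartbeats 4000000 in
set_option synthInstance.maxHeartbeats 400000 in
-- the `SmoothInd` carrier on `U(Φ₃)(L⁺_v)` (class of ★ (B-1a) ∕ ★ d0B `K2E3KeysThmTwoDepthZeroBranchBAssembly`): ★ letters typed on `Gqs L v` meet ★ (B-0)'s generic binders by `exact`
/-- **THE B_pos END ASSEMBLY IN THE (G3) FRAME AT ROCHE'S GROUP `J_e`, GIVEN THE TYPE BASIS AND THE FOUR ENTRIES.**  `v` non-split and UNRAMIFIED in `L` (inert); `χ₁ : (L ⊗ L⁺_v)ˣ → ℂˣ`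
continuous, non-unitary, contracting, of conductor `m + 1` (`hcond` at `|ϖ|^{m+1}`, E-witness `u₁` at `|ϖ|ᵐ`, `1 ≤ m`), `χ₁(u·σu) = 1` on the units of valuation one (Branch B); `e = (r₁, 0; r₂, 1)`,
`r₁ + r₂ = m + 1`, `r₁ ≤ r₂ ≤ r₁ + 1`, `Je = eA⁻¹(Jg)`; `w₀` of matrix `Φ₃`; `μ` a Haar measure on `N(L⁺_v)`; `(f₁, f_w)` a NORMALISED `(J_e, θ)`-type basis of `i(χ₁, 1)` (`θ(g) = χ₁(g₀₀)`) whose four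
cell integrals `Λ_g f = ∫_N f(w₀ n g) dμ`, `g ∈ {1, w₀}`, are integrable and take ★ (B-6)'s CLOSED FORMS (`X = χ₁(ϖ̂)`, `q = N𝔭_v`, `V ≠ 0`, `ε₀² = c₂² = 1`): `Λ_1 f₁ = c₂·(ε₀·((q−1)∕q^{m+2})·V·X∕(1+X))`,
`Λ_{w₀} f_w = −c₂·(ε₀·((q−1)∕q^{m+2})·V∕(1+X))`, `Λ_1 f_w = (q^{2r₁})⁻¹·V`, `Λ_{w₀} f₁ = (q^{2r₂+1})⁻¹·V`.  If `i(χ₁, 1)` is reducible then **`χ₁ = η·‖·‖^{1∕2}` for a continuous quadratic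
character extension `η`** — DISJUNCT 2 of U4Keys :182.  Proof: ★ (B-1a) (trace-one `t` ★ `exists_add_galAdicCompletionMap_eq_one`, `hcondF` §0, `k = 0`) ⟹ type vector `f′`; ★ (B-2b″) `hcells`,
`hwit`; ★ (B-0) ⟹ `det M = 0`; ★ `norm_apply_uniformizer_lt_one`; ★ (B-6) `exists_eta_of_det_eq_zero_of_pairEntries_twoDepth`. [cite: Keys1984, §3, §7 Theorem (2) p. 126]
[cite: Casselman1980, §3] [cite: Casselman1995, §6.4, Thm. 6.6.2] [cite: Roche1998, §3–§4] [cite: Rogawski1990, §12.2 (1)–(2) p. 173] -/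
theorem exists_eta_of_reducible_twoDepth_of_pairEntries
    (hns : ∀ w' : PlacesOver L v, IsCMField.complexConj L • w'.1 = w'.1) (hunr : Algebra.IsUnramifiedIn (𝓞 L) v.asIdeal)
    (χ₁ : (LocalRing L v)ˣ →* ℂˣ) (h₁ : Continuous fun x => ((χ₁ x : ℂˣ) : ℂ)) (hnu : ∃ x, ‖((χ₁ x : ℂˣ) : ℂ)‖ ≠ 1)
    (hcontr : ∀ x : (LocalRing L v)ˣ, unitModulusChar (LocalRing L v) x < 1 → ‖((χ₁ x : ℂˣ) : ℂ)‖ < 1)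
    (hB : ∀ u : (LocalRing L v)ˣ, (∀ w' : PlacesOver L v, Valued.v ((u : LocalRing L v) w') = 1) →
      χ₁ (u * Units.map (conjLocal L (IsCMField.complexConj L) v : LocalRing L v →* LocalRing L v) u) = 1)
    {m : ℕ} (hm : 1 ≤ m)
    (hcond : ∀ u : (LocalRing L v)ˣ, (∀ w' : PlacesOver L v, Valued.v (((u : LocalRing L v) w') - 1) ≤ Valued.v ϖ ^ (m + 1)) → χ₁ u = 1)
    (u₁ : (LocalRing L v)ˣ) (hu₁ : ∀ w' : PlacesOver L v, Valued.v (((u₁ : LocalRing L v) w') - 1) ≤ Valued.v ϖ ^ m) (hχu₁ : χ₁ u₁ ≠ 1)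
    (hrr : r₁ + r₂ = m + 1) (hr12 : r₁ ≤ r₂) (hr21 : r₂ ≤ r₁ + 1)
    [MeasurableSpace ↥(cmBorelTriple L 3 v).N] [BorelSpace ↥(cmBorelTriple L 3 v).N] (μ : Measure ↥(cmBorelTriple L 3 v).N) [μ.IsHaarMeasure]
    (f₁ f_w : haveI := locallyCompactSpace_cmBorelU L 3 v
      Representation.SmoothInd (cmBorelTriple L 3 v).P
        (Representation.twist (((Representation.trivial ℂ ↥(torusU (conjLocal L (IsCMField.complexConj L) v) (cmLocalForm L 3 v)) ℂ).twist
          (cmTorusCharPair L v χ₁ 1)).comp (cmBorelTriple L 3 v).proj) (rootDeltaChar (cmBorelTriple L 3 v).P)))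
    (heig₁ : ∀ x ∈ Je, (haveI := locallyCompactSpace_cmBorelU L 3 v; Representation.smoothIndRep _ _ x f₁) =
      (if h : IsUnit (((x.val : GL (Fin 3) (LocalRing L v)) : Matrix (Fin 3) (Fin 3) (LocalRing L v)) 0 0) then ((χ₁ h.unit : ℂˣ) : ℂ) else 0) • f₁)
    (heig_w : ∀ x ∈ Je, (haveI := locallyCompactSpace_cmBorelU L 3 v; Representation.smoothIndRep _ _ x f_w) =
      (if h : IsUnit (((x.val : GL (Fin 3) (LocalRing L v)) : Matrix (Fin 3) (Fin 3) (LocalRing L v)) 0 0) then ((χ₁ h.unit : ℂˣ) : ℂ) else 0) • f_w)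
    (h11 : f₁.toFun 1 = 1) (h1g : f₁.toFun w₀ = 0) (hw1 : f_w.toFun 1 = 0) (hwg : f_w.toFun w₀ = 1)
    (hi₁₁ : Integrable (fun n : ↥(cmBorelTriple L 3 v).N => f₁.toFun (w₀ * (n : ↥(unitaryGroupOfForm (conjLocal L (IsCMField.complexConj L) v) (cmLocalForm L 3 v))) * 1)) μ)
    (hiw₁ : Integrable (fun n : ↥(cmBorelTriple L 3 v).N => f_w.toFun (w₀ * (n : ↥(unitaryGroupOfForm (conjLocal L (IsCMField.complexConj L) v) (cmLocalForm L 3 v))) * 1)) μ)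
    (hi₁₂ : Integrable (fun n : ↥(cmBorelTriple L 3 v).N => f₁.toFun (w₀ * (n : ↥(unitaryGroupOfForm (conjLocal L (IsCMField.complexConj L) v) (cmLocalForm L 3 v))) * w₀)) μ)
    (hiw₂ : Integrable (fun n : ↥(cmBorelTriple L 3 v).N => f_w.toFun (w₀ * (n : ↥(unitaryGroupOfForm (conjLocal L (IsCMField.complexConj L) v) (cmLocalForm L 3 v))) * w₀)) μ)
    (V ε₀ c₂ : ℂ) (hV : V ≠ 0) (hε : ε₀ ^ 2 = 1) (hc : c₂ ^ 2 = 1)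
    (h11v : ∫ n : ↥(cmBorelTriple L 3 v).N, f₁.toFun (w₀ * (n : ↥(unitaryGroupOfForm (conjLocal L (IsCMField.complexConj L) v) (cmLocalForm L 3 v))) * 1) ∂μ =
      c₂ * (ε₀ * ((((Ideal.absNorm v.asIdeal : ℝ) : ℂ) - 1) / ((Ideal.absNorm v.asIdeal : ℝ) : ℂ) ^ (m + 1 + 1)) * V *
        ((χ₁ (isUnit_toLocalRing_uniformizer L v).unit : ℂˣ) : ℂ) / (1 + ((χ₁ (isUnit_toLocalRing_uniformizer L v).unit : ℂˣ) : ℂ))))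
    (hwwv : ∫ n : ↥(cmBorelTriple L 3 v).N, f_w.toFun (w₀ * (n : ↥(unitaryGroupOfForm (conjLocal L (IsCMField.complexConj L) v) (cmLocalForm L 3 v))) * w₀) ∂μ =
      -(c₂ * (ε₀ * ((((Ideal.absNorm v.asIdeal : ℝ) : ℂ) - 1) / ((Ideal.absNorm v.asIdeal : ℝ) : ℂ) ^ (m + 1 + 1)) * V /
        (1 + ((χ₁ (isUnit_toLocalRing_uniformizer L v).unit : ℂˣ) : ℂ)))))
    (hw1v : ∫ n : ↥(cmBorelTriple L 3 v).N, f_w.toFun (w₀ * (n : ↥(unitaryGroupOfForm (conjLocal L (IsCMField.complexConj L) v) (cmLocalForm L 3 v))) * 1) ∂μ =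
      (((Ideal.absNorm v.asIdeal : ℝ) : ℂ) ^ (2 * r₁))⁻¹ * V)
    (h1wv : ∫ n : ↥(cmBorelTriple L 3 v).N, f₁.toFun (w₀ * (n : ↥(unitaryGroupOfForm (conjLocal L (IsCMField.complexConj L) v) (cmLocalForm L 3 v))) * w₀) ∂μ =
      (((Ideal.absNorm v.asIdeal : ℝ) : ℂ) ^ (2 * r₂ + 1))⁻¹ * V)
    (hred : ∃ N : Subrepresentation (cmPrincipalSeries L 3 v (cmTorusCharPair L v χ₁ 1)), N ≠ ⊥ ∧ N ≠ ⊤) :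
    ∃ η : (LocalRing L v)ˣ →* ℂˣ, IsQuadraticCharExtension (conjLocal L (IsCMField.complexConj L) v) η ∧
      Continuous (fun x => ((η x : ℂˣ) : ℂ)) ∧ χ₁ = η * halfModulusChar (LocalRing L v) := by
  haveI := locallyCompactSpace_cmBorelU L 3 v
  -- the trace-one letter (`v` unramified: the trace `𝒪_w → 𝒪_v` hits `1`) and the F-conductor letter at `c = 1` (§0)
  obtain ⟨t, hvt, ht⟩ := exists_add_galAdicCompletionMap_eq_one L v w hw hunr
  have hcondF : ∀ u : (LocalRing L v)ˣ, Units.map (conjLocal L (IsCMField.complexConj L) v : LocalRing L v →* LocalRing L v) u = u →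
      (∀ w' : PlacesOver L v, Valued.v (((u : LocalRing L v) w') - 1) ≤ Valued.v ϖ ^ (0 + 1)) → χ₁ u = 1 :=
    fun u hσu hu => apply_eq_one_of_map_conjLocal_eq_of_valued_sub_one_le L v hns hunr w hϖ χ₁ hB le_rfl u hσu hu
  -- ★ (B-1a): the `(J_e, θ)`-type vector of the reducible `i(χ₁, 1)`, killed by every `Λ_g`
  obtain ⟨f', heig', hf'1, hΛ'⟩ := K2E3BranchATypeVectorTwoDepth.exists_typeVector_twoDepth L v w hw eA heA hϖ g₁ hg₁ K0 K1 I hK0 hK1 hI r₁ 0 r₂ 1 Jg hJg Je hJe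
    (by omega) le_rfl hns χ₁ h₁ hnu hcontr (Nat.zero_le m) hcond hcondF ht hvt (by omega) (by omega) (by omega) (by omega) w₀ hw₀ μ hred
  -- ★ (B-2b″): the cover `hcells` and the irrelevance witnesses `hwit` of the intermediate cells, `R` = the N̄-shells off `J_e` and off the sharp big cell (abstracted by its test `hR`)
  obtain ⟨R, hR⟩ : ∃ R : Set ↥(unitaryGroupOfForm (conjLocal L (IsCMField.complexConj L) v) (cmLocalForm L 3 v)), ∀ r, r ∈ R ↔
      r ∈ ((cmBorelTriple L 3 v).N).map (MulAut.conj w₀).toMonoidHom ∧ r ∉ Je ∧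
        ¬ (Valued.v ((((eA r : ↥(unitaryGroupOfForm (galAdicCompletionMap (L := L) (IsCMField.complexConj L) hw) ((StdForm.antidiagonal 3).over (w.1.adicCompletion L)))) : GL (Fin 3) (w.1.adicCompletion L)) : Matrix (Fin 3) (Fin 3) (w.1.adicCompletion L)) 2 1 /
              (((eA r : ↥(unitaryGroupOfForm (galAdicCompletionMap (L := L) (IsCMField.complexConj L) hw) ((StdForm.antidiagonal 3).over (w.1.adicCompletion L)))) : GL (Fin 3) (w.1.adicCompletion L)) : Matrix (Fin 3) (Fin 3) (w.1.adicCompletion L)) 2 0) ≤ Valued.v ϖ ^ r₁ ∧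
            (Valued.v ϖ ^ 0)⁻¹ ≤ Valued.v ((((eA r : ↥(unitaryGroupOfForm (galAdicCompletionMap (L := L) (IsCMField.complexConj L) hw) ((StdForm.antidiagonal 3).over (w.1.adicCompletion L)))) : GL (Fin 3) (w.1.adicCompletion L)) : Matrix (Fin 3) (Fin 3) (w.1.adicCompletion L)) 2 0)) :=
    ⟨{r | _}, fun _ => Iff.rfl⟩
  have hcells := BposCellCoverTwoDepthKZeroCM.cells_cover_kZero L v w hw eA heA hϖ r₁ r₂ Jg hJg Je hJe w₀ hw₀ R hR
  have hwit := BposCellCoverTwoDepthKZeroCM.cells_witness_kZero L v w hw eA heA hϖ r₁ r₂ Jg hJg Je hJe w₀ hw₀ R hR hm hrr hr12 hr21 hunr χ₁ hcontr hcond u₁ hu₁ hχu₁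
  -- ★ (B-0): `det M = 0` on the `(J_e, θ)`-plane (`H := P`, `B := J_e`, `g₀ := w₀`, `g₁ := 1`, `g₂ := w₀`, `f := f′`)
  have hdet := BranchBDeterminantVanishingCells.det_intertwiningIntegral_eq_zero_of_typeVector_of_cells (cmBorelTriple L 3 v).P
    (Representation.twist (((Representation.trivial ℂ ↥(torusU (conjLocal L (IsCMField.complexConj L) v) (cmLocalForm L 3 v)) ℂ).twist
      (cmTorusCharPair L v χ₁ 1)).comp (cmBorelTriple L 3 v).proj) (rootDeltaChar (cmBorelTriple L 3 v).P))
    Je (fun g : ↥(unitaryGroupOfForm (conjLocal L (IsCMField.complexConj L) v) (cmLocalForm L 3 v)) =>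
      if h : IsUnit (((g : GL (Fin 3) (LocalRing L v)) : Matrix (Fin 3) (Fin 3) (LocalRing L v)) 0 0) then ((χ₁ h.unit : ℂˣ) : ℂ) else 0)
    w₀ _ hwit hcells (cmBorelTriple L 3 v).N μ w₀ 1 w₀ f₁ f_w heig₁ heig_w h11 h1g hw1 hwg hi₁₁ hiw₁ hi₁₂ hiw₂ f' heig' hf'1 (hΛ' 1) (hΛ' w₀)
  -- `|X| < 1` (contraction) and ★ (B-6)
  have hY := K2E3KeysThmTwoDepthZeroBranchBConstants.norm_apply_uniformizer_lt_one L v w hw hunr χ₁ hcontr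
  exact BposDeterminantClosedForm.exists_eta_of_det_eq_zero_of_pairEntries_twoDepth L v hns hunr χ₁ h₁ hB (m + 1) r₁ r₂ hrr V ε₀ c₂ _ _ _ _ hV hε hc hY
    h11v hwwv hw1v h1wv hdet

end Frame

/-! ## §2 The leaf, frame-free, hypothesis-first: the head (B-7⁺) binders + ONE letter `HE` (the four entries for every frame and every type basis) -/

open Classical in
set_option maxHeartbeats 4000000 in
set_option synthInstance.maxHeartbeats 400000 in
-- §1 instantiated: the (G3) frame (★ d0B leaf pattern), ★ (B1) conductor letters, ★ D174 `Jg`, ★ (B-8) θ-letters, ★ (B-1′) basis, the letter `HE`, `Measure.haar` on `N(L⁺_v)`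
/-- **U4Keys :182 IN BRANCH B AT POSITIVE DEPTH, ALL INERT PLACES — THE LEAF, HYPOTHESIS-FIRST.**  Binders = the head (B-7⁺) `exists_eta_of_reducible_posDepth_normTrivial_inertAll` (R-S1-17:
the frozen (B-7) d21b054346b3bcdc with `h2` DELETED; `hram` is not used and therefore not a binder here): `v` non-split (`hns`) and UNRAMIFIED in `L` (`hunr`); `χ₁ : (L ⊗ L⁺_v)ˣ → ℂˣ` continuous
(`h₁`), non-unitary (`hnu`), contracting (`hcontr`), of POSITIVE depth (`hpos`), with `χ₁(u·σu) = 1` on the units of valuation one (`hB`, Branch B); PLUS the one letter **`HE`** = «in every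
(G3) frame `(w, eA, ϖ, g₁, K₀, K₁, I)`, for every conductor datum `(m ≥ 1, hcond at |ϖ|^{m+1}, u₁ at |ϖ|ᵐ with χ₁ u₁ ≠ 1)`, every aligned pair `r₁ + r₂ = m + 1`, `r₁ ≤ r₂ ≤ r₁ + 1` with its
two-depth group `Je = eA⁻¹(Jg)`, `e = (r₁, 0; r₂, 1)`, every `w₀` of matrix `Φ₃`, every Borel Haar measure `μ` on `N(L⁺_v)` and every NORMALISED `(J_e, θ)`-type basis `(f₁, f_w)` of `i(χ₁, 1)`:
the four cell integrals `∫_N f(w₀ n g) dμ` are integrable and equal ★ (B-6)'s closed forms for SOME `V ≠ 0`, `ε₀² = 1`, `c₂² = 1`» (memo (M11), (M22), (M12), (M21); payers: the integral side).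
If `i(χ₁, 1)` is reducible then **`χ₁ = η·‖·‖^{1∕2}` for a continuous quadratic character extension `η`** — DISJUNCT 2 of :182.  Proof: ★ (B1) `exists_conductor_letters`, `(r₁, r₂) :=
(⌊(m+1)∕2⌋, ⌈(m+1)∕2⌉)`, the frame as ★ `K2E3BranchAIrreducibleTwoDepthLeaf` builds it, ★ D174 `exists_subgroup_forall_mem_iff_twoDepth`, `μ := Measure.haar`, ★ (B-8) `theta_mul_twoDepth` (trace-one
`t` ★ `exists_add_galAdicCompletionMap_eq_one`, `hcondF` §0) + `exists_isOpen_subgroup_theta_eq_one`, ★ (B-1′) `exists_normalised_typeBasis_twoDepth_of_normChar_eq_one`, `HE`, §1.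
[cite: Keys1984, §3, §7 Theorem (2) (b)–(d) p. 126] [cite: Casselman1980, §3] [cite: Casselman1995, §6.4, Thm. 6.6.2] [cite: Roche1998, §3–§4] [cite: Rogawski1990, §12.2 (1)–(2) p. 173] -/
theorem exists_eta_of_reducible_posDepth_normTrivial_inertAll_of_pairEntries
    (hns : ∀ w' : PlacesOver L v, IsCMField.complexConj L • w'.1 = w'.1)
    (hunr : Algebra.IsUnramifiedIn (𝓞 L) v.asIdeal)
    (χ₁ : (LocalRing L v)ˣ →* ℂˣ) (h₁ : Continuous fun x => ((χ₁ x : ℂˣ) : ℂ)) (hnu : ∃ x, ‖((χ₁ x : ℂˣ) : ℂ)‖ ≠ 1)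
    (hcontr : ∀ x : (LocalRing L v)ˣ, unitModulusChar (LocalRing L v) x < 1 → ‖((χ₁ x : ℂˣ) : ℂ)‖ < 1)
    (hpos : ∃ u : (LocalRing L v)ˣ, (∀ w' : PlacesOver L v, Valued.v (((u : LocalRing L v) w') - 1) < 1) ∧ χ₁ u ≠ 1)
    (hB : ∀ u : (LocalRing L v)ˣ, (∀ w' : PlacesOver L v, Valued.v ((u : LocalRing L v) w') = 1) →
      χ₁ (u * Units.map (conjLocal L (IsCMField.complexConj L) v : LocalRing L v →* LocalRing L v) u) = 1)
    (HE : ∀ (w : PlacesOver L v) (hw : IsCMField.complexConj L • w.1 = w.1)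
      (eA : Gqs L v ≃ₜ* ↥(unitaryGroupOfForm (galAdicCompletionMap (L := L) (IsCMField.complexConj L) hw) ((StdForm.antidiagonal 3).over (w.1.adicCompletion L))))
      (_heA : ∀ g : Gqs L v,
        ((eA g : ↥(unitaryGroupOfForm (galAdicCompletionMap (L := L) (IsCMField.complexConj L) hw) ((StdForm.antidiagonal 3).over (w.1.adicCompletion L)))) :
            GL (Fin 3) (w.1.adicCompletion L)) =
          ((localNonsplitEquiv (IsCMField.complexConj L) (qsForm L) (IsCMField.complexConj_ne_one L) w hw g :
            ↥(unitaryGroupOfForm (galAdicCompletionMap (L := L) (IsCMField.complexConj L) hw) (placeForm (qsForm L) w.1))) : GL (Fin 3) (w.1.adicCompletion L)))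
      (ϖ : w.1.adicCompletion L) (_hϖ : Valued.v ϖ = WithZero.exp (-1 : ℤ))
      (g₁ : GL (Fin 3) (w.1.adicCompletion L)) (_hg₁ : (g₁ : Matrix (Fin 3) (Fin 3) (w.1.adicCompletion L)) = Matrix.diagonal ![(1 : w.1.adicCompletion L), 1, ϖ])
      (K0 K1 I : Subgroup (Gqs L v))
      (_hK0 : K0 = ((glInt 3 (w.1.adicCompletion L)).subgroupOf
        (unitaryGroupOfForm (galAdicCompletionMap (L := L) (IsCMField.complexConj L) hw) ((StdForm.antidiagonal 3).over (w.1.adicCompletion L)))).comap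
          eA.toMulEquiv.toMonoidHom)
      (_hK1 : K1 = (((glInt 3 (w.1.adicCompletion L)).map (MulAut.conj g₁).toMonoidHom).subgroupOf
        (unitaryGroupOfForm (galAdicCompletionMap (L := L) (IsCMField.complexConj L) hw) ((StdForm.antidiagonal 3).over (w.1.adicCompletion L)))).comap
          eA.toMulEquiv.toMonoidHom)
      (_hI : I = K0 ⊓ K1)
      (m : ℕ) (_hm : 1 ≤ m)
      (_hcond : ∀ u : (LocalRing L v)ˣ, (∀ w' : PlacesOver L v, Valued.v (((u : LocalRing L v) w') - 1) ≤ Valued.v ϖ ^ (m + 1)) → χ₁ u = 1)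
      (u₁ : (LocalRing L v)ˣ) (_hu₁ : ∀ w' : PlacesOver L v, Valued.v (((u₁ : LocalRing L v) w') - 1) ≤ Valued.v ϖ ^ m) (_hχu₁ : χ₁ u₁ ≠ 1)
      (r₁ r₂ : ℕ) (_hrr : r₁ + r₂ = m + 1) (_hr12 : r₁ ≤ r₂) (_hr21 : r₂ ≤ r₁ + 1)
      (Jg : Subgroup ↥(unitaryGroupOfForm (galAdicCompletionMap (L := L) (IsCMField.complexConj L) hw) ((StdForm.antidiagonal 3).over (w.1.adicCompletion L))))
      (_hJg : ∀ k : ↥(unitaryGroupOfForm (galAdicCompletionMap (L := L) (IsCMField.complexConj L) hw) ((StdForm.antidiagonal 3).over (w.1.adicCompletion L))),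
        k ∈ Jg ↔ ∀ i j, Valued.v (((k : GL (Fin 3) (w.1.adicCompletion L)) : Matrix (Fin 3) (Fin 3) (w.1.adicCompletion L)) i j) ≤
          Valued.v ϖ ^ (![![0, r₁, 0], ![r₂, 0, r₁], ![1, r₂, 0]] : Fin 3 → Fin 3 → ℕ) i j)
      (Je : Subgroup (Gqs L v)) (_hJe : Je = Jg.comap eA.toMulEquiv.toMonoidHom)
      (w₀ : ↥(unitaryGroupOfForm (conjLocal L (IsCMField.complexConj L) v) (cmLocalForm L 3 v))) (_hw₀ : Units.val (w₀ : GL (Fin 3) (LocalRing L v)) = cmLocalForm L 3 v)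
      [MeasurableSpace ↥(cmBorelTriple L 3 v).N] [BorelSpace ↥(cmBorelTriple L 3 v).N] (μ : Measure ↥(cmBorelTriple L 3 v).N) [μ.IsHaarMeasure]
      (f₁ f_w : haveI := locallyCompactSpace_cmBorelU L 3 v
        Representation.SmoothInd (cmBorelTriple L 3 v).P
          (Representation.twist (((Representation.trivial ℂ ↥(torusU (conjLocal L (IsCMField.complexConj L) v) (cmLocalForm L 3 v)) ℂ).twist
            (cmTorusCharPair L v χ₁ 1)).comp (cmBorelTriple L 3 v).proj) (rootDeltaChar (cmBorelTriple L 3 v).P))),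
      (∀ x ∈ Je, (haveI := locallyCompactSpace_cmBorelU L 3 v; Representation.smoothIndRep _ _ x f₁) =
        (if h : IsUnit (((x.val : GL (Fin 3) (LocalRing L v)) : Matrix (Fin 3) (Fin 3) (LocalRing L v)) 0 0) then ((χ₁ h.unit : ℂˣ) : ℂ) else 0) • f₁) →
      (∀ x ∈ Je, (haveI := locallyCompactSpace_cmBorelU L 3 v; Representation.smoothIndRep _ _ x f_w) =
        (if h : IsUnit (((x.val : GL (Fin 3) (LocalRing L v)) : Matrix (Fin 3) (Fin 3) (LocalRing L v)) 0 0) then ((χ₁ h.unit : ℂˣ) : ℂ) else 0) • f_w) →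
      f₁.toFun 1 = 1 → f₁.toFun w₀ = 0 → f_w.toFun 1 = 0 → f_w.toFun w₀ = 1 →
      ∃ V ε₀ c₂ : ℂ, V ≠ 0 ∧ ε₀ ^ 2 = 1 ∧ c₂ ^ 2 = 1 ∧
        Integrable (fun n : ↥(cmBorelTriple L 3 v).N => f₁.toFun (w₀ * (n : ↥(unitaryGroupOfForm (conjLocal L (IsCMField.complexConj L) v) (cmLocalForm L 3 v))) * 1)) μ ∧
        Integrable (fun n : ↥(cmBorelTriple L 3 v).N => f_w.toFun (w₀ * (n : ↥(unitaryGroupOfForm (conjLocal L (IsCMField.complexConj L) v) (cmLocalForm L 3 v))) * 1)) μ ∧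
        Integrable (fun n : ↥(cmBorelTriple L 3 v).N => f₁.toFun (w₀ * (n : ↥(unitaryGroupOfForm (conjLocal L (IsCMField.complexConj L) v) (cmLocalForm L 3 v))) * w₀)) μ ∧
        Integrable (fun n : ↥(cmBorelTriple L 3 v).N => f_w.toFun (w₀ * (n : ↥(unitaryGroupOfForm (conjLocal L (IsCMField.complexConj L) v) (cmLocalForm L 3 v))) * w₀)) μ ∧
        (∫ n : ↥(cmBorelTriple L 3 v).N, f₁.toFun (w₀ * (n : ↥(unitaryGroupOfForm (conjLocal L (IsCMField.complexConj L) v) (cmLocalForm L 3 v))) * 1) ∂μ =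
          c₂ * (ε₀ * ((((Ideal.absNorm v.asIdeal : ℝ) : ℂ) - 1) / ((Ideal.absNorm v.asIdeal : ℝ) : ℂ) ^ (m + 1 + 1)) * V *
            ((χ₁ (isUnit_toLocalRing_uniformizer L v).unit : ℂˣ) : ℂ) / (1 + ((χ₁ (isUnit_toLocalRing_uniformizer L v).unit : ℂˣ) : ℂ)))) ∧
        (∫ n : ↥(cmBorelTriple L 3 v).N, f_w.toFun (w₀ * (n : ↥(unitaryGroupOfForm (conjLocal L (IsCMField.complexConj L) v) (cmLocalForm L 3 v))) * w₀) ∂μ =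
          -(c₂ * (ε₀ * ((((Ideal.absNorm v.asIdeal : ℝ) : ℂ) - 1) / ((Ideal.absNorm v.asIdeal : ℝ) : ℂ) ^ (m + 1 + 1)) * V /
            (1 + ((χ₁ (isUnit_toLocalRing_uniformizer L v).unit : ℂˣ) : ℂ))))) ∧
        (∫ n : ↥(cmBorelTriple L 3 v).N, f_w.toFun (w₀ * (n : ↥(unitaryGroupOfForm (conjLocal L (IsCMField.complexConj L) v) (cmLocalForm L 3 v))) * 1) ∂μ =
          (((Ideal.absNorm v.asIdeal : ℝ) : ℂ) ^ (2 * r₁))⁻¹ * V) ∧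
        (∫ n : ↥(cmBorelTriple L 3 v).N, f₁.toFun (w₀ * (n : ↥(unitaryGroupOfForm (conjLocal L (IsCMField.complexConj L) v) (cmLocalForm L 3 v))) * w₀) ∂μ =
          (((Ideal.absNorm v.asIdeal : ℝ) : ℂ) ^ (2 * r₂ + 1))⁻¹ * V))
    (hred : ∃ N : Subrepresentation (cmPrincipalSeries L 3 v (cmTorusCharPair L v χ₁ 1)), N ≠ ⊥ ∧ N ≠ ⊤) :
    ∃ η : (LocalRing L v)ˣ →* ℂˣ, IsQuadraticCharExtension (conjLocal L (IsCMField.complexConj L) v) η ∧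
      Continuous (fun x => ((η x : ℂˣ) : ℂ)) ∧ χ₁ = η * halfModulusChar (LocalRing L v) := by
  obtain ⟨w⟩ : Nonempty (PlacesOver L v) := inferInstance
  have hw : IsCMField.complexConj L • w.1 = w.1 := hns w
  -- the (G3)-EXPLICIT frame letters (★ `K2E3KeysThmTwoDepthZeroBranchBInertLeaf` ∕ ★ `K2E3BranchAIrreducibleTwoDepthLeaf` pattern): a uniformiser, `g₁ = diag(1,1,ϖ)`, `eA =` ★ `localNonsplitEquiv` on `Φ₃`
  obtain ⟨ϖ, hϖ⟩ : ∃ τ : w.1.adicCompletion L, Valued.v τ = WithZero.exp (-1 : ℤ) := by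
    obtain ⟨π, hπ⟩ := w.1.valuation_exists_uniformizer L
    exact ⟨(π : w.1.adicCompletion L), by rw [HeightOneSpectrum.valuedAdicCompletion_eq_valuation', hπ]⟩
  have hϖ0 : ϖ ≠ 0 := fun h0 => by rw [h0, map_zero] at hϖ; exact WithZero.zero_ne_coe hϖ
  have hvσ : ∀ x, Valued.v (galAdicCompletionMap (L := L) (IsCMField.complexConj L) hw x) = Valued.v x :=
    fun x => valued_galAdicCompletionMap (L := L) (IsCMField.complexConj L) hw x
  obtain ⟨g₁, hg₁⟩ : ∃ g₁ : GL (Fin 3) (w.1.adicCompletion L), (g₁ : Matrix (Fin 3) (Fin 3) (w.1.adicCompletion L)) = Matrix.diagonal ![(1 : w.1.adicCompletion L), 1, ϖ] := by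
    refine ⟨glDiagonal 3 (w.1.adicCompletion L) ![1, 1, Units.mk0 ϖ hϖ0], ?_⟩
    rw [coe_glDiagonal]
    congr 1
    funext i
    fin_cases i <;> rfl
  have hJw : placeForm (qsForm L) w.1 = (StdForm.antidiagonal 3).over (w.1.adicCompletion L) := by
    rw [placeForm, qsForm, antidiagOne_eq_over, StdForm.over_map]
  obtain ⟨eA, heA⟩ : ∃ eA : Gqs L v ≃ₜ* ↥(unitaryGroupOfForm (galAdicCompletionMap (L := L) (IsCMField.complexConj L) hw) ((StdForm.antidiagonal 3).over (w.1.adicCompletion L))),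
      ∀ g : Gqs L v, ((eA g : ↥(unitaryGroupOfForm (galAdicCompletionMap (L := L) (IsCMField.complexConj L) hw) ((StdForm.antidiagonal 3).over (w.1.adicCompletion L)))) :
          GL (Fin 3) (w.1.adicCompletion L)) =
        ((localNonsplitEquiv (IsCMField.complexConj L) (qsForm L) (IsCMField.complexConj_ne_one L) w hw g :
          ↥(unitaryGroupOfForm (galAdicCompletionMap (L := L) (IsCMField.complexConj L) hw) (placeForm (qsForm L) w.1))) : GL (Fin 3) (w.1.adicCompletion L)) := by
    rw [← hJw]
    exact ⟨localNonsplitEquiv (IsCMField.complexConj L) (qsForm L) (IsCMField.complexConj_ne_one L) w hw, fun g => rfl⟩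
  -- `w₀ = eA⁻¹(w_long)` has matrix `Φ₃` (only its matrix is used: the element is abstracted)
  obtain ⟨w₀, hw₀⟩ : ∃ w₀ : ↥(unitaryGroupOfForm (conjLocal L (IsCMField.complexConj L) v) (cmLocalForm L 3 v)),
      Units.val (w₀ : GL (Fin 3) (LocalRing L v)) = cmLocalForm L 3 v := by
    refine ⟨eA.symm (weylLongU (galAdicCompletionMap (L := L) (IsCMField.complexConj L) hw) (rfl : (StdForm.antidiagonal 3).over (w.1.adicCompletion L) = _)),
      Matrix.ext fun i j => ?_⟩
    rw [LocalRing.eq_iff_apply_eq (IsCMField.complexConj L) (IsCMField.complexConj_ne_one L) w hw,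
      ← coe_eA_apply L v w hw eA heA (eA.symm (weylLongU (galAdicCompletionMap (L := L) (IsCMField.complexConj L) hw) rfl)) i j,
      ContinuousMulEquiv.apply_symm_apply, coe_coe_weylLongU, cmLocalForm_eq_over]
    have h := congr_fun (congr_fun ((StdForm.antidiagonal 3).over_map (Pi.evalRingHom (fun w' : PlacesOver L v => w'.1.adicCompletion L) w)) i) j
    rw [Matrix.map_apply, Pi.evalRingHom_apply] at h
    exact h.symm
  -- ★ (B1): the conductor `m + 1 ≥ 2` (`hcond`) and its exact witness `u₁`; Roche's exponents `(r₁, r₂) = (⌊(m+1)∕2⌋, ⌈(m+1)∕2⌉)`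
  obtain ⟨m, hm, hcond, u₁, hu₁, hχu₁⟩ := K2E3LocalCharacterConductorLetters.exists_conductor_letters L v w hϖ χ₁ h₁ hpos
  obtain ⟨r₁, r₂, hrr, hr12, hr21⟩ : ∃ r₁ r₂ : ℕ, r₁ + r₂ = m + 1 ∧ r₁ ≤ r₂ ∧ r₂ ≤ r₁ + 1 :=
    ⟨(m + 1) / 2, m + 1 - (m + 1) / 2, by omega, by omega, by omega⟩
  -- ★ D174: Roche's two-depth group `Jg` at `e = (r₁, 0; r₂, 1)` (concavity from the alignment) and `Je := eA⁻¹(Jg)`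
  obtain ⟨Jg, hJg⟩ := K2E3IwahoriTwoDepthFactorisation.exists_subgroup_forall_mem_iff_twoDepth (galAdicCompletionMap (L := L) (IsCMField.complexConj L) hw)
    (rfl : (StdForm.antidiagonal 3).over (w.1.adicCompletion L) = _) hvσ hϖ (r := r₁) (s := 0) (r' := r₂) (s' := 1)
    (by omega) (by omega) (by omega) (by omega)
  -- the Haar measure of the closed subgroup `N(L⁺_v)` on its Borel σ-algebra
  letI : MeasurableSpace ↥(cmBorelTriple L 3 v).N := borel _
  haveI : BorelSpace ↥(cmBorelTriple L 3 v).N := ⟨rfl⟩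
  haveI : LocallyCompactSpace ↥(unitaryGroupOfForm (conjLocal L (IsCMField.complexConj L) v) (cmLocalForm L 3 v)) :=
    locallyCompactSpace_local (IsCMField.complexConj L) 3 _ v
  haveI : LocallyCompactSpace ↥(cmBorelTriple L 3 v).N :=
    (LineRing.isClosed_unipotentU (conjLocal L (IsCMField.complexConj L) v) (cmLocalForm L 3 v)).isClosedEmbedding_subtypeVal.locallyCompactSpace
  -- ★ (B-8): the θ-letters of ★ (B-1′) — `hθmul` (trace-one `t`, `hcondF` §0 at `c = 1`) and the C-pack
  obtain ⟨t, hvt, ht⟩ := exists_add_galAdicCompletionMap_eq_one L v w hw hunr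
  have hcondF : ∀ u : (LocalRing L v)ˣ, Units.map (conjLocal L (IsCMField.complexConj L) v : LocalRing L v →* LocalRing L v) u = u →
      (∀ w' : PlacesOver L v, Valued.v (((u : LocalRing L v) w') - 1) ≤ Valued.v ϖ ^ 1) → χ₁ u = 1 :=
    fun u hσu hu => apply_eq_one_of_map_conjLocal_eq_of_valued_sub_one_le L v hns hunr w hϖ χ₁ hB le_rfl u hσu hu
  have hθmul := BposCongruencePackTheta.theta_mul_twoDepth L v w hw eA heA hϖ r₁ 0 r₂ 1 Jg hJg _ rfl (by omega) le_rfl χ₁ (n := m + 1) (c := 1) le_rfl (by omega)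
    hcond hcondF ht hvt (by omega) (by omega) (by omega) (by omega)
  obtain ⟨C, hCo, hθC⟩ := BposCongruencePackTheta.exists_isOpen_subgroup_theta_eq_one L v w hw eA heA hϖ (m + 1) (by omega) χ₁ hcond
  -- ★ (B-1′): the normalised `(J_e, θ)`-type basis `(f₁, f_w)` of `i(χ₁, 1)` (Branch B)
  obtain ⟨f₁, f_w, heig₁, heig_w, h11, h1g, hw1, hwg⟩ :=
    BposBranchBTypeBasisTwoDepthCM.exists_normalised_typeBasis_twoDepth_of_normChar_eq_one L v w hw eA heA hϖ g₁ hg₁ _ _ _ rfl rfl rfl r₁ 0 r₂ 1 Jg hJg _ rfl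
      w₀ hw₀ (by omega) le_rfl χ₁ hB hθmul C hCo hθC
  -- the letter `HE` at this frame and this basis
  obtain ⟨V, ε₀, c₂, hV, hε, hc, hi₁₁, hiw₁, hi₁₂, hiw₂, h11v, hwwv, hw1v, h1wv⟩ :=
    HE w hw eA heA ϖ hϖ g₁ hg₁ _ _ _ rfl rfl rfl m hm hcond u₁ hu₁ hχu₁ r₁ r₂ hrr hr12 hr21 Jg hJg _ rfl w₀ hw₀ Measure.haar f₁ f_w heig₁ heig_w h11 h1g hw1 hwg
  -- §1
  exact exists_eta_of_reducible_twoDepth_of_pairEntries L v w hw eA heA hϖ g₁ hg₁ _ _ _ rfl rfl rfl r₁ r₂ Jg hJg _ rfl w₀ hw₀ hns hunr χ₁ h₁ hnu hcontr hB hm hcond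
    u₁ hu₁ hχu₁ hrr hr12 hr21 Measure.haar f₁ f_w heig₁ heig_w h11 h1g hw1 hwg hi₁₁ hiw₁ hi₁₂ hiw₂ V ε₀ c₂ hV hε hc h11v hwwv hw1v h1wv hred

end Summit.HodgeConjecture.HodgeConjecture.R90.S1.KeysThmTwoPosDepthBranchBInertAllLeaf

end
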